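import Summits.BirchSwinnertonDyer.BirchSwinnertonDyer.Theorems.ClassRecordThreeCornerAtThreeShimuraFamilySign
import Summits.BirchSwinnertonDyer.BirchSwinnertonDyer.Theorems.ClassRecordThreeCornerAtThreeShimuraFamilyLabels
import HarnessLib

/-!
# SINGLE-DATUM producers for tam3-p1's GROSS-keyed (P2) assembly on a Shimura frame: the extension of a datum to a divisor
# family and the SIGN `hsign` (Gross 5.4) for EVERY datum `d` with `d.y = ys n`
# (cell `bsd-stepL`, seat `bsd-stepL-corner3-p2` g8 = WIDTH-LEVER lane B; `--supports stmt-BirchSwinnertonDyer-21420 --as helper`)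

WHY (CORNER3-G8.md §4; tam3-p1 g13 `Koly.familyLevelSupply_of_memberships`, mirror c64263de25e8871d). That assembly's producer binders
quantify over ALL `d : JET.KolyvaginFamilyData W K ι n` with `d.y = ys n`. Lane B's label-consuming producers (p600503 sign, p600152 ∕
p602831 Kummer, p601020 key relation) are stated for DIVISOR-INDEXED families `d : (m ∣ n) → KolyvaginFamilyData W K ι m`. THIS FILE
bridges the two shapes: (§1) any datum `d` at level `n` with `d.y = ys n` EXTENDS to a divisor family `D` with `D n = d` and `D.y = ys`
(lower levels from `exists_familyData_y_eq`; tam3-p1's p604825 does the same inline for its `hP`); (§2) Gross 5.4 for every datum, in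
the closing composition's binder shape `hsign` (p600503 on the extension; admissibility taken in the composition's ∀-datum shape `hA`).
(The bottom `P_1 = y_K` is tam3-p1's `…KolyvaginFamilyBottom`; the invariance `hP` is its p604825.)

RESULTS (namespace `Summit.BirchSwinnertonDyer.BirchSwinnertonDyer.Theorems.ShimuraWalk`):
* `exists_familyData_extension` — §1.
* `pointsMap_derivedPoint_familyData_of_labelsAt` — `hsign` for every datum with `d.y = ys n`.

HONEST FRAMING. Helper lemmas toward crux 21420 `CornerAtThreeW` (line `Lines/inert.lean` r7, stub `stub_upper3_residualMulti`) and
19109; nothing about BSD, `J₃`, or any divisibility of a Heegner point is asserted; no stub is discharged; no item closes; 0 classes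
move (T7). `K : Type`. References: [cite: GrossLMS1991, §4 (4.1), Prop. 5.4] [cite: BertoliniDarmon1990, Prop. 2.6].
Axioms: `propext`, `Classical.choice`, `Quot.sound`.
-/

set_option autoImplicit false
set_option linter.dupNamespace false

noncomputable section

open scoped Classical

namespace Summit.BirchSwinnertonDyer.BirchSwinnertonDyer.Theorems.ShimuraWalk

open WeierstrassCurve Field NumberField IsDedekindDomain Finset
  Literature.NumberTheory.EllipticCurves Literature.NumberTheory.GaloisRepresentations
  Literature.NumberTheory.EllipticCurves.KolyvaginCocycle
  Literature.NumberTheory.EllipticCurves.KolyvaginEuler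
  Literature.NumberTheory.EllipticCurves.RingClassField
  Literature.NumberTheory.EllipticCurves.ModularForms
  Summit.BirchSwinnertonDyer.Rank1Residual.X11b
  Summit.BirchSwinnertonDyer.Rank1Residual.JET
  Summit.BirchSwinnertonDyer.BirchSwinnertonDyer.Theorems

variable {K : Type} [Field K] [NumberField K] {W : WeierstrassCurve ℚ} {ι : K →+* ℂ}

/-! ## §1 Extension of a datum to a divisor family -/

/-- **A datum at level `n` with `d.y = ys n` extends to a divisor-indexed family with `D n = d` and `(D m).y = ys m`** (lower
levels: any datum with the prescribed point, `exists_familyData_y_eq`). [cite: GrossLMS1991, §3 (3.4), §4 (4.1)] -/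
theorem exists_familyData_extension (hK : IsImaginaryQuadratic K) (ι : K →+* ℂ) {n : ℕ} (hn : Squarefree n)
    (hinert : ∀ q ∈ n.primeFactors, (Ideal.span {(q : 𝓞 K)}).IsPrime)
    (ys : (m : ℕ) → (W.baseChange (ringClassField K ι m)).toAffine.Point)
    (d : KolyvaginFamilyData W K ι n) (hdy : d.y = ys n) :
    ∃ D : (m : ℕ) → m ∣ n → KolyvaginFamilyData W K ι m, D n dvd_rfl = d ∧ ∀ (m : ℕ) (hm : m ∣ n), (D m hm).y = ys m := by
  have hex : ∀ m : ℕ, m ∣ n → ∃ dm : KolyvaginFamilyData W K ι m, dm.y = ys m := fun m hm ↦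
    exists_familyData_y_eq (W := W) hK ι (hn.squarefree_of_dvd hm)
      (fun q hq ↦ hinert q (Nat.primeFactors_mono hm hn.ne_zero hq)) ys
  refine ⟨fun m hm ↦ if h : m = n then h ▸ d else (hex m hm).choose, ?_, fun m hm ↦ ?_⟩
  · dsimp only
    rw [dif_pos rfl]
  · by_cases h : m = n
    · subst h
      dsimp only
      rw [dif_pos rfl]
      exact hdy
    · dsimp only
      rw [dif_neg h]
      exact (hex m hm).choose_spec

/-! ## §2 The sign `hsign` for every datum -/

/-- **The producer `hsign` (Gross Prop. 5.4 on points) for EVERY datum with `d.y = ys n`** on a Shimura frame carrying `LabelsAt`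
(labels (B3), (B4)) with admissible `E(K[m])` (the composition's `hA`): `τ̃ P_n = ε (−1)^{#primes} P_n + p^j B`, `B ∈ E(K[n])`,
for `1 ≤ j ≤ M_Gross(n)`. p600503 `pointsMap_derivedPoint_familyData_of_labels` on the extension of §1.
[cite: GrossLMS1991, Prop. 5.4 (1)] [cite: BertoliniDarmon1990, Prop. 2.6] -/
theorem pointsMap_derivedPoint_familyData_of_labelsAt {N : ℕ} [NeZero N] [W.IsElliptic] [W.IsGloballyMinimal]
    (hK : IsImaginaryQuadratic K) (ι : K →+* ℂ) (Dt : ModularParametrizationData W N) {p : ℕ} (hp : p.Prime)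
    (ys : (m : ℕ) → (W.baseChange (ringClassField K ι m)).toAffine.Point)
    {yK : (W.baseChange K).toAffine.Point} {ε : ℤ} (hL : LabelsAt W N K ι yK ys ε)
    (hA : ∀ (m : ℕ) (dm : KolyvaginFamilyData W K ι m), dm.y = ys m → Squarefree m →
      (∀ q ∈ m.primeFactors, IsKolyvaginPrime N W K p q) →
      ∀ j : ℕ, IsAdmissible (absoluteGaloisGroup K) dm.pointsSubgroup ((p ^ j : ℕ) : ℤ))
    {c : K ≃ₐ[ℚ] K} (hc : c ≠ 1) {τ : AlgebraicClosure K ≃+* AlgebraicClosure K} (hτ : IsLiftOfAut c τ)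
    (n : ℕ) (d : KolyvaginFamilyData W K ι n) (hdy : d.y = ys n) (hn : Squarefree n)
    (hKol : ∀ q ∈ n.primeFactors, IsKolyvaginPrime N W K p q)
    (j : ℕ) (hj : 1 ≤ j) (hjM : (j : ℕ∞) ≤ frobLevelIndex W K p n) :
    ∃ B ∈ d.pointsSubgroup, hτ.pointsMap W (d.toGeomPoints d.derivedPoint) =
      (ε * (-1) ^ n.primeFactors.card) • d.toGeomPoints d.derivedPoint + ((p ^ j : ℕ) : ℤ) • B := by
  have hn0 : n ≠ 0 := hn.ne_zero
  have hfrob : ∀ q ∈ n.primeFactors, FrobEqFrobInfty W K (p ^ j) q := (natCast_le_frobLevelIndex_iff hKol j).mp hjM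
  have hguard : ∀ q ∈ n.primeFactors, ¬ q ∣ N ∧ (Ideal.span {(q : 𝓞 K)}).IsPrime :=
    fun q hq ↦ ⟨(hKol q hq).2.1, (hKol q hq).2.2.2.2.1⟩
  obtain ⟨D, hDd, hDy⟩ := exists_familyData_extension (W := W) hK ι hn (fun q hq ↦ (hguard q hq).2) ys d hdy
  subst hDd
  obtain ⟨hB4d, -, hB3d⟩ := familyLabels_of_labelsAt (W := W) hn hguard ys hL D hDy
  have hA' : ∀ (m : ℕ) (hm : m ∣ n), IsAdmissible (absoluteGaloisGroup K) (D m hm).pointsSubgroup ((p ^ j : ℕ) : ℤ) :=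
    fun m hm ↦ hA m (D m hm) (hDy m hm) (hn.squarefree_of_dvd hm) (fun q hq ↦ hKol q (Nat.primeFactors_mono hm hn0 hq)) j
  exact pointsMap_derivedPoint_familyData_of_labels hK ι hp hj Dt hn (fun q hq ↦ ⟨hKol q hq, hfrob q hq⟩) D hc hτ ε
    hB4d hB3d hA' n dvd_rfl

end Summit.BirchSwinnertonDyer.BirchSwinnertonDyer.Theorems.ShimuraWalk

end
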